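import Mathlib
import Literature.Dynamics.FixedPoints.HyperbolicFixedPoint
import HarnessLib

/-!
# Rung C1 of the crux `EulerZoomLiouville.PowerGaugeEulerLiouville`: LYAPUNOV PAIRS on invariant subspaces give a
# HYPERBOLIC SPLITTING of `exp A` (route №10, item stmt-NavierStokesRegularity-19832; `--supports`)

Helper file (theorems only). Seat ns-typeII-p3 (cell ns-regularity-ideate §B, D-0081).  Second sequel to
`…SelfSimilarFiniteHyperbolic` (step (M) of the crux idea «hyperbolic-stagnation exclusion»): the THIN alternative
there is a hyperbolic splitting (`Literature.Dynamics.FixedPoints.IsHyperbolicSplitting`: complementary invariant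
closed subspaces, some iterate contracting `Es` by `½` and expanding `Eu` by `2`) of `D(Φ_1)(z) = exp DW(z)`
(`…SelfSimilarTimeOneLinearisation`).  This file produces such splittings from quadratic Lyapunov data, on any
finite-dimensional real inner product space `F`, for `A : F →L[ℝ] F`:

* `hasDerivAt_exp_smul_apply` — `s ↦ exp(sA) x` solves `u' = A u`;
* `exp_smul_apply_mem` / `exp_apply_mem` — an `A`-invariant subspace is `exp(sA)`-invariant (partial sums of the
  exponential series stay in the closed subspace);
* `exp_pow_eq_exp_smul` / `exp_pow_apply` — `(exp A)^n = exp(nA)`;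
* `inner_exp_smul_apply_ge` / `inner_exp_smul_apply_le` — Grönwall along `exp(sA)` on an invariant subspace `S`
  carrying a symmetric `G` with `⟪G(Ah),h⟫ ≥ μ⟪Gh,h⟫` (resp. `≤ −μ⟪Gh,h⟫`): `⟪G e^{sA}x, e^{sA}x⟫ ≥ e^{2μs}⟪Gx,x⟫`
  (resp. `≤ e^{−2μs}⟪Gx,x⟫`), `s ≥ 0`;
* `exists_two_mul_norm_le_exp_pow_apply` / `exists_norm_exp_pow_apply_le_half` — with `G` coercive
  (`⟪Gh,h⟫ ≥ g₀‖h‖²`) and `μ > 0`, some iterate `(exp A)^n` expands (resp. contracts) `S` by the factor `2`;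
* **`isHyperbolicSplitting_exp`** — complementary `A`-invariant subspaces `Es`, `Eu` carrying such Lyapunov pairs of
  opposite signs form a hyperbolic splitting of `exp A`.

WHAT THIS IS NOT: not NS, not E, not rung C1 — linear ODE / linear algebra serving step (M); no fluid content.
[folklore; cf. HaleMagalhaesOliva2002 §6.1, Def. 7.2.1 (hyperbolic splitting with rates); Robinson1999 Ch. V §5.10]
-/

noncomputable section

-- flat `Theorems/<Route><Decl>…` files of one crux share the namespace of the crux (tree convention)
set_option linter.dupNamespace false

open MeasureTheory Set Filter Topology Metric Function InnerProductSpace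
open scoped RealInnerProductSpace NNReal ContDiff Nat

namespace Summit.NavierStokesRegularity.NavierStokesRegularity.Theorems.PowerGaugeEulerLiouville.Kelvin

open Literature.Dynamics.FixedPoints

section LinearODE

variable {F : Type*} [NormedAddCommGroup F] [InnerProductSpace ℝ F] [FiniteDimensional ℝ F] [CompleteSpace F]


omit [FiniteDimensional ℝ F] in
/-- `s ↦ exp(sA) x` solves `u' = A u`. [folklore] -/
theorem hasDerivAt_exp_smul_apply
    (A : F →L[ℝ] F) (x : F) (s : ℝ) :
    HasDerivAt (fun r : ℝ => NormedSpace.exp (r • A) x) (A (NormedSpace.exp (s • A) x)) s := by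
  have h := (hasDerivAt_exp_smul_const' A s).clm_apply (hasDerivAt_const s x)
  simpa using h

/-- **An `A`-invariant subspace is invariant under `exp(sA)`** (partial sums of the exponential series stay in the
closed subspace). [folklore] -/
theorem exp_smul_apply_mem (A : F →L[ℝ] F)
    {S : Submodule ℝ F} (hS : ∀ x ∈ S, A x ∈ S)
    {x : F} (hx : x ∈ S) (s : ℝ) :
    NormedSpace.exp (s • A) x ∈ S := by
  have hsum := NormedSpace.exp_series_hasSum_exp' (𝕂 := ℝ) (s • A)
  have h2 : HasSum (fun n : ℕ => (((n ! : ℝ)⁻¹) • (s • A) ^ n) x) (NormedSpace.exp (s • A) x) :=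
    hsum.mapL (ContinuousLinearMap.apply ℝ (F) x)
  have hpow : ∀ n : ℕ, ((s • A) ^ n) x ∈ S := by
    intro n
    induction n with
    | zero => simpa using hx
    | succ n ih =>
        rw [pow_succ']
        change s • A (((s • A) ^ n) x) ∈ S
        exact S.smul_mem _ (hS _ ih)
  refine (Submodule.closed_of_finiteDimensional S).mem_of_tendsto h2.tendsto_sum_nat
    (Eventually.of_forall fun N => ?_)
  refine Submodule.sum_mem _ fun n _ => ?_
  change ((n ! : ℝ)⁻¹) • (((s • A) ^ n) x) ∈ S
  exact S.smul_mem _ (hpow n)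

/-- In particular an `A`-invariant subspace is invariant under `exp A`. [folklore] -/
theorem exp_apply_mem (A : F →L[ℝ] F)
    {S : Submodule ℝ F} (hS : ∀ x ∈ S, A x ∈ S) {x : F} (hx : x ∈ S) :
    NormedSpace.exp A x ∈ S := by
  have h := exp_smul_apply_mem A hS hx 1
  rwa [one_smul] at h

omit [FiniteDimensional ℝ F] in
/-- Powers of the time-one exponential are the integer-time exponentials: `(exp A)^n = exp(n A)`. [folklore] -/
theorem exp_pow_eq_exp_smul (A : F →L[ℝ] F) (n : ℕ) :
    NormedSpace.exp A ^ n = NormedSpace.exp ((n : ℝ) • A) := by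
  have hr : ∀ y : F →L[ℝ] F,
      y ∈ Metric.eball (0 : F →L[ℝ] F) (NormedSpace.expSeries ℝ (F →L[ℝ] F)).radius := by
    intro y
    rw [Metric.mem_eball, NormedSpace.expSeries_radius_eq_top]
    exact edist_lt_top _ _
  induction n with
  | zero => rw [pow_zero, Nat.cast_zero, zero_smul, NormedSpace.exp_zero]
  | succ n ih =>
      rw [pow_succ, ih, Nat.cast_succ, add_smul, one_smul,
        NormedSpace.exp_add_of_commute_of_mem_ball ((Commute.refl A).smul_left (n : ℝ)) (hr _) (hr _)]

omit [FiniteDimensional ℝ F] in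
/-- Iterates of the time-one exponential are the integer-time exponentials: `(exp A)^n x = exp(n A) x`. [folklore] -/
theorem exp_pow_apply (A : F →L[ℝ] F) (n : ℕ) (x : F) :
    (NormedSpace.exp A ^ n) x = NormedSpace.exp ((n : ℝ) • A) x := by
  rw [exp_pow_eq_exp_smul]

/-- **Grönwall along `exp(sA)` on an invariant subspace (expansion)**: if `S` is `A`-invariant and `G` is symmetric
with `⟪G(Ah), h⟫ ≥ μ⟪Gh,h⟫` on `S`, then `⟪G e^{sA}x, e^{sA}x⟫ ≥ e^{2μs}⟪Gx,x⟫` for `x ∈ S`, `s ≥ 0`. [folklore] -/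
theorem inner_exp_smul_apply_ge (A G : F →L[ℝ] F)
    {S : Submodule ℝ F} (hS : ∀ x ∈ S, A x ∈ S)
    (hGsym : ∀ u v : F, ⟪G u, v⟫ = ⟪u, G v⟫) {μ : ℝ}
    (hu : ∀ h ∈ S, μ * ⟪G h, h⟫ ≤ ⟪G (A h), h⟫) {x : F} (hx : x ∈ S)
    {s : ℝ} (hs : 0 ≤ s) :
    Real.exp (2 * μ * s) * ⟪G x, x⟫ ≤ ⟪G (NormedSpace.exp (s • A) x), NormedSpace.exp (s • A) x⟫ := by
  set u : ℝ → F := fun r => NormedSpace.exp (r • A) x with hudef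
  set q : ℝ → ℝ := fun r => ⟪G (u r), u r⟫ with hq
  have hu' : ∀ r, HasDerivAt u (A (u r)) r := fun r => hasDerivAt_exp_smul_apply A x r
  have hq' : ∀ r, HasDerivAt q (2 * ⟪G (A (u r)), u r⟫) r := by
    intro r
    have hGu : HasDerivAt (fun r => G (u r)) (G (A (u r))) r := (G.hasFDerivAt.comp_hasDerivAt r (hu' r))
    have h := hGu.inner ℝ (hu' r)
    refine h.congr_deriv ?_
    rw [hGsym (u r) (A (u r)), real_inner_comm (G (A (u r))) (u r)]
    ring
  -- `F(r) = e^{−2μr} q(r)` is non-decreasing on `[0, ∞)`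
  set F : ℝ → ℝ := fun r => Real.exp (-(2 * μ) * r) * q r with hF
  have hF' : ∀ r, HasDerivAt F (Real.exp (-(2 * μ) * r) * (-(2 * μ)) * q r +
      Real.exp (-(2 * μ) * r) * (2 * ⟪G (A (u r)), u r⟫)) r := by
    intro r
    have hexp : HasDerivAt (fun r => Real.exp (-(2 * μ) * r)) (Real.exp (-(2 * μ) * r) * (-(2 * μ))) r := by
      simpa using ((hasDerivAt_id r).const_mul (-(2 * μ))).exp
    exact hexp.mul (hq' r)
  have hmono : MonotoneOn F (Ici 0) := by
    have hFc : Continuous F := continuous_iff_continuousAt.2 fun r => (hF' r).continuousAt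
    refine monotoneOn_of_hasDerivWithinAt_nonneg (convex_Ici 0) hFc.continuousOn
      (fun r _ => (hF' r).hasDerivWithinAt) fun r _ => ?_
    have h1 := hu (u r) (exp_smul_apply_mem A hS hx r)
    have hpos : 0 < Real.exp (-(2 * μ) * r) := Real.exp_pos _
    nlinarith
  have h1 : F 0 ≤ F s := hmono (mem_Ici.2 le_rfl) (mem_Ici.2 hs) hs
  have hu0 : u 0 = x := by
    simp only [hudef]
    rw [zero_smul, NormedSpace.exp_zero]
    rfl
  simp only [hF, hq, mul_zero, Real.exp_zero, one_mul, hu0] at h1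
  have hexp : Real.exp (2 * μ * s) * Real.exp (-(2 * μ) * s) = 1 := by
    rw [← Real.exp_add]; ring_nf; simp
  calc Real.exp (2 * μ * s) * ⟪G x, x⟫
      ≤ Real.exp (2 * μ * s) * (Real.exp (-(2 * μ) * s) * ⟪G (u s), u s⟫) :=
        mul_le_mul_of_nonneg_left h1 (Real.exp_pos _).le
    _ = ⟪G (u s), u s⟫ := by rw [← mul_assoc, hexp, one_mul]

/-- **Grönwall along `exp(sA)` on an invariant subspace (contraction)**: if `S` is `A`-invariant and `G` is
symmetric with `⟪G(Ah), h⟫ ≤ −μ⟪Gh,h⟫` on `S`, then `⟪G e^{sA}x, e^{sA}x⟫ ≤ e^{−2μs}⟪Gx,x⟫` for `x ∈ S`, `s ≥ 0`.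
[folklore] -/
theorem inner_exp_smul_apply_le (A G : F →L[ℝ] F)
    {S : Submodule ℝ F} (hS : ∀ x ∈ S, A x ∈ S)
    (hGsym : ∀ u v : F, ⟪G u, v⟫ = ⟪u, G v⟫) {μ : ℝ}
    (hle : ∀ h ∈ S, ⟪G (A h), h⟫ ≤ -μ * ⟪G h, h⟫) {x : F} (hx : x ∈ S)
    {s : ℝ} (hs : 0 ≤ s) :
    ⟪G (NormedSpace.exp (s • A) x), NormedSpace.exp (s • A) x⟫ ≤ Real.exp (-(2 * μ) * s) * ⟪G x, x⟫ := by
  set u : ℝ → F := fun r => NormedSpace.exp (r • A) x with hudef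
  set q : ℝ → ℝ := fun r => ⟪G (u r), u r⟫ with hq
  have hu' : ∀ r, HasDerivAt u (A (u r)) r := fun r => hasDerivAt_exp_smul_apply A x r
  have hq' : ∀ r, HasDerivAt q (2 * ⟪G (A (u r)), u r⟫) r := by
    intro r
    have hGu : HasDerivAt (fun r => G (u r)) (G (A (u r))) r := (G.hasFDerivAt.comp_hasDerivAt r (hu' r))
    have h := hGu.inner ℝ (hu' r)
    refine h.congr_deriv ?_
    rw [hGsym (u r) (A (u r)), real_inner_comm (G (A (u r))) (u r)]
    ring
  -- `F(r) = e^{2μr} q(r)` is non-increasing on `[0, ∞)`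
  set F : ℝ → ℝ := fun r => Real.exp ((2 * μ) * r) * q r with hF
  have hF' : ∀ r, HasDerivAt F (Real.exp ((2 * μ) * r) * (2 * μ) * q r +
      Real.exp ((2 * μ) * r) * (2 * ⟪G (A (u r)), u r⟫)) r := by
    intro r
    have hexp : HasDerivAt (fun r => Real.exp ((2 * μ) * r)) (Real.exp ((2 * μ) * r) * (2 * μ)) r := by
      simpa using ((hasDerivAt_id r).const_mul (2 * μ)).exp
    exact hexp.mul (hq' r)
  have hanti : AntitoneOn F (Ici 0) := by
    have hFc : Continuous F := continuous_iff_continuousAt.2 fun r => (hF' r).continuousAt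
    refine antitoneOn_of_hasDerivWithinAt_nonpos (convex_Ici 0) hFc.continuousOn
      (fun r _ => (hF' r).hasDerivWithinAt) fun r _ => ?_
    have h1 := hle (u r) (exp_smul_apply_mem A hS hx r)
    have hpos : 0 < Real.exp ((2 * μ) * r) := Real.exp_pos _
    nlinarith
  have h1 : F s ≤ F 0 := hanti (mem_Ici.2 le_rfl) (mem_Ici.2 hs) hs
  have hu0 : u 0 = x := by
    simp only [hudef]
    rw [zero_smul, NormedSpace.exp_zero]
    rfl
  simp only [hF, hq, mul_zero, Real.exp_zero, one_mul, hu0] at h1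
  have hexp : Real.exp (-(2 * μ) * s) * Real.exp ((2 * μ) * s) = 1 := by
    rw [← Real.exp_add]; ring_nf; simp
  calc ⟪G (u s), u s⟫ = Real.exp (-(2 * μ) * s) * (Real.exp ((2 * μ) * s) * ⟪G (u s), u s⟫) := by
        rw [← mul_assoc, hexp, one_mul]
    _ ≤ Real.exp (-(2 * μ) * s) * ⟪G x, x⟫ := mul_le_mul_of_nonneg_left h1 (Real.exp_pos _).le

/-- **A Lyapunov pair on an invariant subspace gives eventual EXPANSION by the factor 2**: `S` `A`-invariant, `G`
symmetric with `⟪Gh,h⟫ ≥ g₀‖h‖²` (`g₀ > 0`) and `⟪G(Ah),h⟫ ≥ μ⟪Gh,h⟫` on `S` (`μ > 0`) ⇒ for some `n`,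
`2‖x‖ ≤ ‖(exp A)^n x‖` for all `x ∈ S`. [folklore; cf. HaleMagalhaesOliva2002 Def. 7.2.1] -/
theorem exists_two_mul_norm_le_exp_pow_apply (A G : F →L[ℝ] F)
    {S : Submodule ℝ F} (hS : ∀ x ∈ S, A x ∈ S)
    (hGsym : ∀ u v : F, ⟪G u, v⟫ = ⟪u, G v⟫) {g₀ : ℝ} (hg₀ : 0 < g₀)
    (hGpos : ∀ h : F, g₀ * ‖h‖ ^ 2 ≤ ⟪G h, h⟫) {μ : ℝ} (hμ : 0 < μ)
    (hu : ∀ h ∈ S, μ * ⟪G h, h⟫ ≤ ⟪G (A h), h⟫) :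
    ∃ n : ℕ, ∀ x ∈ S, 2 * ‖x‖ ≤ ‖(NormedSpace.exp A ^ n) x‖ := by
  -- choose `n` with `e^{2μn} g₀ ≥ 4‖G‖`
  obtain ⟨n, hn⟩ := exists_nat_ge (4 * ‖G‖ / g₀ / (2 * μ))
  refine ⟨n, fun x hx => ?_⟩
  have hn' : 4 * ‖G‖ ≤ g₀ * Real.exp (2 * μ * n) := by
    have h1 : 4 * ‖G‖ / g₀ ≤ 2 * μ * n := by
      rw [div_le_iff₀ (by positivity : (0 : ℝ) < 2 * μ)] at hn
      linarith
    have h2 : 2 * μ * (n : ℝ) + 1 ≤ Real.exp (2 * μ * n) := Real.add_one_le_exp _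
    rw [div_le_iff₀ hg₀] at h1
    nlinarith
  rw [exp_pow_apply]
  set y := NormedSpace.exp ((n : ℝ) • A) x with hy
  have hlow := inner_exp_smul_apply_ge A G hS hGsym hu hx (s := (n : ℝ)) (Nat.cast_nonneg n)
  rw [← hy] at hlow
  -- `g₀ e^{2μn} ‖x‖² ≤ ⟪G y, y⟫ ≤ ‖G‖ ‖y‖²`
  have hup : ⟪G y, y⟫ ≤ ‖G‖ * ‖y‖ ^ 2 := by
    calc ⟪G y, y⟫ ≤ ‖G y‖ * ‖y‖ := real_inner_le_norm _ _
      _ ≤ ‖G‖ * ‖y‖ * ‖y‖ := mul_le_mul_of_nonneg_right (G.le_opNorm y) (norm_nonneg _)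
      _ = ‖G‖ * ‖y‖ ^ 2 := by ring
  have hchain : 4 * ‖G‖ * ‖x‖ ^ 2 ≤ ‖G‖ * ‖y‖ ^ 2 := by
    have h1 : g₀ * Real.exp (2 * μ * n) * ‖x‖ ^ 2 ≤ ‖G‖ * ‖y‖ ^ 2 := by
      calc g₀ * Real.exp (2 * μ * n) * ‖x‖ ^ 2 = Real.exp (2 * μ * n) * (g₀ * ‖x‖ ^ 2) := by ring
        _ ≤ Real.exp (2 * μ * n) * ⟪G x, x⟫ := mul_le_mul_of_nonneg_left (hGpos x) (Real.exp_pos _).le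
        _ ≤ ⟪G y, y⟫ := hlow
        _ ≤ ‖G‖ * ‖y‖ ^ 2 := hup
    nlinarith [sq_nonneg ‖x‖]
  by_cases hx0 : x = 0
  · simp [hx0]
  · have hGpos' : 0 < ‖G‖ := by
      have h1 := hGpos x
      have h2 : 0 < g₀ * ‖x‖ ^ 2 := mul_pos hg₀ (pow_pos (norm_pos_iff.2 hx0) 2)
      have h3 : ⟪G x, x⟫ ≤ ‖G‖ * ‖x‖ ^ 2 := by
        calc ⟪G x, x⟫ ≤ ‖G x‖ * ‖x‖ := real_inner_le_norm _ _
          _ ≤ ‖G‖ * ‖x‖ * ‖x‖ := mul_le_mul_of_nonneg_right (G.le_opNorm x) (norm_nonneg _)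
          _ = ‖G‖ * ‖x‖ ^ 2 := by ring
      by_contra hcon
      push Not at hcon
      have : ‖G‖ = 0 := le_antisymm hcon (norm_nonneg _)
      rw [this, zero_mul] at h3
      linarith
    have h4 : 4 * ‖x‖ ^ 2 ≤ ‖y‖ ^ 2 := by
      have := hchain
      nlinarith
    nlinarith [norm_nonneg x, norm_nonneg y, sq_nonneg (‖y‖ - 2 * ‖x‖)]

/-- **A Lyapunov pair on an invariant subspace gives eventual CONTRACTION by the factor ½**: `S` `A`-invariant, `G`
symmetric with `⟪Gh,h⟫ ≥ g₀‖h‖²` (`g₀ > 0`) and `⟪G(Ah),h⟫ ≤ −μ⟪Gh,h⟫` on `S` (`μ > 0`) ⇒ for some `n`,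
`‖(exp A)^n x‖ ≤ ½‖x‖` for all `x ∈ S`. [folklore; cf. HaleMagalhaesOliva2002 Def. 7.2.1] -/
theorem exists_norm_exp_pow_apply_le_half (A G : F →L[ℝ] F)
    {S : Submodule ℝ F} (hS : ∀ x ∈ S, A x ∈ S)
    (hGsym : ∀ u v : F, ⟪G u, v⟫ = ⟪u, G v⟫) {g₀ : ℝ} (hg₀ : 0 < g₀)
    (hGpos : ∀ h : F, g₀ * ‖h‖ ^ 2 ≤ ⟪G h, h⟫) {μ : ℝ} (hμ : 0 < μ)
    (hle : ∀ h ∈ S, ⟪G (A h), h⟫ ≤ -μ * ⟪G h, h⟫) :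
    ∃ n : ℕ, ∀ x ∈ S, ‖(NormedSpace.exp A ^ n) x‖ ≤ 2⁻¹ * ‖x‖ := by
  obtain ⟨n, hn⟩ := exists_nat_ge (4 * ‖G‖ / g₀ / (2 * μ))
  refine ⟨n, fun x hx => ?_⟩
  have hn' : 4 * ‖G‖ ≤ g₀ * Real.exp (2 * μ * n) := by
    have h1 : 4 * ‖G‖ / g₀ ≤ 2 * μ * n := by
      rw [div_le_iff₀ (by positivity : (0 : ℝ) < 2 * μ)] at hn
      linarith
    have h2 : 2 * μ * (n : ℝ) + 1 ≤ Real.exp (2 * μ * n) := Real.add_one_le_exp _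
    rw [div_le_iff₀ hg₀] at h1
    nlinarith
  rw [exp_pow_apply]
  set y := NormedSpace.exp ((n : ℝ) • A) x with hy
  have hupper := inner_exp_smul_apply_le A G hS hGsym hle hx (s := (n : ℝ)) (Nat.cast_nonneg n)
  rw [← hy] at hupper
  -- `g₀ ‖y‖² ≤ ⟪G y, y⟫ ≤ e^{−2μn} ⟪G x, x⟫ ≤ e^{−2μn} ‖G‖ ‖x‖²`
  have hGx : ⟪G x, x⟫ ≤ ‖G‖ * ‖x‖ ^ 2 := by
    calc ⟪G x, x⟫ ≤ ‖G x‖ * ‖x‖ := real_inner_le_norm _ _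
      _ ≤ ‖G‖ * ‖x‖ * ‖x‖ := mul_le_mul_of_nonneg_right (G.le_opNorm x) (norm_nonneg _)
      _ = ‖G‖ * ‖x‖ ^ 2 := by ring
  have h1 : g₀ * ‖y‖ ^ 2 ≤ Real.exp (-(2 * μ) * n) * (‖G‖ * ‖x‖ ^ 2) :=
    (hGpos y).trans (hupper.trans (mul_le_mul_of_nonneg_left hGx (Real.exp_pos _).le))
  -- multiply by `e^{2μn}`: `g₀ e^{2μn} ‖y‖² ≤ ‖G‖‖x‖² ≤ (g₀ e^{2μn}/4) ‖x‖²`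
  have hexp : Real.exp (2 * μ * n) * Real.exp (-(2 * μ) * n) = 1 := by
    rw [← Real.exp_add]; ring_nf; simp
  have h2 : g₀ * Real.exp (2 * μ * n) * ‖y‖ ^ 2 ≤ ‖G‖ * ‖x‖ ^ 2 := by
    calc g₀ * Real.exp (2 * μ * n) * ‖y‖ ^ 2 = Real.exp (2 * μ * n) * (g₀ * ‖y‖ ^ 2) := by ring
      _ ≤ Real.exp (2 * μ * n) * (Real.exp (-(2 * μ) * n) * (‖G‖ * ‖x‖ ^ 2)) :=
          mul_le_mul_of_nonneg_left h1 (Real.exp_pos _).le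
      _ = ‖G‖ * ‖x‖ ^ 2 := by rw [← mul_assoc, hexp, one_mul]
  have hE : 0 < g₀ * Real.exp (2 * μ * n) := mul_pos hg₀ (Real.exp_pos _)
  have h3 : 4 * ‖y‖ ^ 2 ≤ ‖x‖ ^ 2 := by
    -- `4‖G‖ ≤ g₀ e^{2μn}` and `g₀e^{2μn}‖y‖² ≤ ‖G‖‖x‖²` ⇒ `4‖G‖·‖y‖² ≤ ‖G‖‖x‖²`... use `g₀e^{2μn}` directly
    have h4 : 4 * ‖G‖ * ‖y‖ ^ 2 ≤ g₀ * Real.exp (2 * μ * n) * ‖y‖ ^ 2 :=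
      mul_le_mul_of_nonneg_right hn' (sq_nonneg _)
    by_cases hx0 : x = 0
    · have hy0 : y = 0 := by rw [hy, hx0, map_zero]
      simp [hx0, hy0]
    · have hGpos' : 0 < ‖G‖ := by
        have h5 := hGpos x
        have h6 : 0 < g₀ * ‖x‖ ^ 2 := mul_pos hg₀ (pow_pos (norm_pos_iff.2 hx0) 2)
        by_contra hcon
        push Not at hcon
        have : ‖G‖ = 0 := le_antisymm hcon (norm_nonneg _)
        rw [this, zero_mul] at hGx
        linarith
      nlinarith
  nlinarith [norm_nonneg x, norm_nonneg y, sq_nonneg (2 * ‖y‖ - ‖x‖)]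

/-- **Hyperbolic splitting of `exp A` from Lyapunov pairs.**  Let `Es, Eu` be complementary `A`-invariant
subspaces of `ℝ³`, with symmetric coercive forms `Gs`, `Gu` such that `⟪Gs(Ah),h⟫ ≤ −μs⟪Gs h,h⟫` on `Es` and
`⟪Gu(Ah),h⟫ ≥ μu⟪Gu h,h⟫` on `Eu` (`μs, μu > 0`).  Then `(Es, Eu)` is a hyperbolic splitting of `exp A` in the
sense of `Literature.Dynamics.FixedPoints.IsHyperbolicSplitting`. [cite: HaleMagalhaesOliva2002, §6.1 and Def. 7.2.1] -/
theorem isHyperbolicSplitting_exp (A Gs Gu : F →L[ℝ] F)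
    {Es Eu : Submodule ℝ F} (hcompl : IsCompl Es Eu)
    (hAs : ∀ x ∈ Es, A x ∈ Es) (hAu : ∀ x ∈ Eu, A x ∈ Eu)
    (hGs_sym : ∀ u v : F, ⟪Gs u, v⟫ = ⟪u, Gs v⟫) {gs : ℝ} (hgs : 0 < gs)
    (hGs_pos : ∀ h : F, gs * ‖h‖ ^ 2 ≤ ⟪Gs h, h⟫) {μs : ℝ} (hμs : 0 < μs)
    (hs : ∀ h ∈ Es, ⟪Gs (A h), h⟫ ≤ -μs * ⟪Gs h, h⟫)
    (hGu_sym : ∀ u v : F, ⟪Gu u, v⟫ = ⟪u, Gu v⟫) {gu : ℝ} (hgu : 0 < gu)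
    (hGu_pos : ∀ h : F, gu * ‖h‖ ^ 2 ≤ ⟪Gu h, h⟫) {μu : ℝ} (hμu : 0 < μu)
    (hu : ∀ h ∈ Eu, μu * ⟪Gu h, h⟫ ≤ ⟪Gu (A h), h⟫) :
    IsHyperbolicSplitting (NormedSpace.exp A) Es Eu where
  isClosed_stable := Submodule.closed_of_finiteDimensional Es
  isClosed_unstable := Submodule.closed_of_finiteDimensional Eu
  isCompl := hcompl
  mapsTo_stable := fun _ hx => exp_apply_mem A hAs hx
  mapsTo_unstable := fun _ hx => exp_apply_mem A hAu hx
  finiteDimensional_unstable := inferInstance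
  eventually_contracting := exists_norm_exp_pow_apply_le_half A Gs hAs hGs_sym hgs hGs_pos hμs hs
  eventually_expanding := exists_two_mul_norm_le_exp_pow_apply A Gu hAu hGu_sym hgu hGu_pos hμu hu

end LinearODE


end Summit.NavierStokesRegularity.NavierStokesRegularity.Theorems.PowerGaugeEulerLiouville.Kelvin

end
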